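import Summits.QuantumFields.QCD.Theses.NestedDissectionSea
import Literature.MathematicalPhysics.QuantumLattice.TopologicalCriticalMass
import Literature.MathematicalPhysics.QuantumLattice.WilsonPositivityDomain
import Summits.QuantumFields.QCD.Theorems.EarlyCrosserLaw.Negative.CellPositivityDomain

/-!
# Stub `stub_zeroExtensionQuasimode` of line `cells-inherit-torus-extinction`
(crux `Summit.QuantumFields.QCD.Theses.NestedDissectionSea.EarlyCrosserLaw`,
item stmt-QuantumFields-13995)

**S1 — zero-extension transfer (deterministic).** On the four-torus `(ℤ/N)⁴`, for every
`SU(3)` gauge field `U`, bare mass `μ`, open box of corner `x` and sides `t ≤ N`, and every kernel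
vector `w` of the Dirichlet cell `wilsonCell U μ x t` (`D_c w = 0`), the zero-extension
`ŵ q = if q ∈ box then w q else 0` is a quasimode of the TORUS Wilson–Dirac operator
`D_W = wilsonDirac (fundamentalRep (Fin 3)) U μ 1` with defect controlled by the FACE MASS of `w`:
`Σ_p ‖(D_W ŵ)(p)‖² ≤ 64 · Σ_{q ∈ box, q on a first/last interior layer} ‖w q‖²`.

Proof (operator-norm locality):
* inside the box `(D_W ŵ)(p) = (D_c w)(p) = 0` (`Matrix.toSquareBlockProp` restricts both indices;
  `mulVec_zeroExt_apply_of_mem`);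
* the Wilson–Dirac matrix couples only equal or nearest-neighbour sites, and a box site which is
  NOT on a first/last interior layer has all its torus neighbours inside the box (`t ≤ N`
  excludes wrap-around; `siteBox_of_adjacent`), so outside the box `D_W ŵ = D_W ŵ_face` with
  `ŵ_face` the zero-extension of the face part of `w` (`wilsonDirac_apply_eq_zero_of_not_mem`,
  `norm_sq_mulVec_zeroExt_le`);
* outside the box `ŵ_face = 0`, so there `D_W ŵ_face = -(Σ_μ W_μ) ŵ_face`
  (`wilsonDirac_eq_sub_sum_wilsonHop`), and `‖Σ_μ W_μ‖ ≤ 4` (`l2_opNorm_sum_wilsonHop_le`)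
  gives `Σ_p ‖(D_W ŵ)(p)‖² ≤ 16 · faceMass ≤ 64 · faceMass` (`sum_norm_sq_mulVec_le`,
  `sum_norm_sq_faceExt`).
-/

noncomputable section

open Matrix Complex Filter MeasureTheory
open Literature.MathematicalPhysics.QuantumLattice Literature.MathematicalPhysics.QuantumFieldTheory
  Literature.Probability.LatticeModels
open scoped ComplexConjugate BigOperators

namespace Summit.QuantumFields.QCD.Cruxes.EarlyCrosserLaw.CellsInheritTorusExtinction

/-! ## One-dimensional bookkeeping on `ZMod N` -/

/-- A residue `a : ZMod N` with `0 < a.val < T ≤ N` which is NOT on the first or last layer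
(`a.val ≠ 1`, `a.val + 1 ≠ T`) has both neighbours `a ± 1` still in `(0, T)` (no wrap-around
since `a.val + 1 < T ≤ N`). [folklore] -/
private theorem zmod_neighbours_mem {N : ℕ} [NeZero N] {a : ZMod N} {T : ℕ} (hT : T ≤ N)
    (h0 : 0 < a.val) (h1 : a.val < T) (hf1 : a.val ≠ 1) (hf2 : a.val + 1 ≠ T) :
    (0 < (a + 1).val ∧ (a + 1).val < T) ∧ (0 < (a - 1).val ∧ (a - 1).val < T) := by
  have hN1 : N ≠ 1 := by omega
  have hv1 : (1 : ZMod N).val = 1 := ZMod.val_one'' hN1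
  have hadd : (a + 1).val = a.val + 1 := by
    rw [ZMod.val_add, hv1, Nat.mod_eq_of_lt (by omega)]
  have hsub : (a - 1).val = a.val - 1 := by
    rw [ZMod.val_sub (by rw [hv1]; omega), hv1]
  rw [hadd, hsub]
  omega

/-- **No leak from the deep interior.** If the site `y` lies in the open box `(x, t)` with
`t ≤ N` and is not on a first/last interior layer in any direction, then every torus neighbour `z`
of `y` (`z = y + ν̂` or `y = z + ν̂`) lies in the open box as well. [folklore] -/
private theorem siteBox_of_adjacent {N : ℕ} [NeZero N] {x y z : TorusSite 4 N} {t : Fin 4 → ℕ}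
    (ht : ∀ i, t i ≤ N) (hy : ∀ i, 0 < (y i - x i).val ∧ (y i - x i).val < t i)
    (hface : ¬ ∃ i, (y i - x i).val = 1 ∨ (y i - x i).val + 1 = t i) {ν : Fin 4}
    (hz : z = Literature.MathematicalPhysics.QuantumFieldTheory.Site.shift y ν ∨
      y = Literature.MathematicalPhysics.QuantumFieldTheory.Site.shift z ν) (i : Fin 4) :
    0 < (z i - x i).val ∧ (z i - x i).val < t i := by
  push Not at hface
  obtain ⟨h0, h1⟩ := hy i
  obtain ⟨hf1, hf2⟩ := hface i
  obtain ⟨hadd, hsub⟩ := zmod_neighbours_mem (ht i) h0 h1 hf1 hf2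
  have key : z i = y i ∨ z i = y i + 1 ∨ z i = y i - 1 := by
    rcases hz with rfl | rfl
    · by_cases hi : i = ν
      · subst hi
        simp [Literature.MathematicalPhysics.QuantumFieldTheory.Site.shift]
      · left
        simp [Literature.MathematicalPhysics.QuantumFieldTheory.Site.shift, hi]
    · by_cases hi : i = ν
      · subst hi
        right; right
        simp [Literature.MathematicalPhysics.QuantumFieldTheory.Site.shift]
      · left
        simp [Literature.MathematicalPhysics.QuantumFieldTheory.Site.shift, hi]
  rcases key with h | h | h
  · rw [h]; exact ⟨h0, h1⟩
  · rw [h, add_sub_right_comm]; exact hadd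
  · rw [h, sub_right_comm]; exact hsub

/-! ## Locality of the Wilson–Dirac matrix -/

section Locality

variable {N : ℕ} [NeZero N]

-- adapted from `Literature.MathematicalPhysics.QuantumLattice.wilsonDirac_apply_eq_zero_of_far`
-- (`WilsonPropagatorHeavyMass.lean`, not imported here)
omit [NeZero N] in
/-- The Wilson–Dirac matrix couples only equal or nearest-neighbour sites: its `(p, q)` entry
vanishes unless `p.1 = q.1` or `q.1 = p.1 + μ̂` or `p.1 = q.1 + μ̂` for some `μ`. [folklore] -/
private theorem wilsonDirac_apply_eq_zero_of_far' (U : GaugeConfig 4 N SU3) (m r : ℝ)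
    {p q : TorusSite 4 N × Fin 3 × Fin 4} (h0 : p.1 ≠ q.1)
    (h1 : ∀ ν, q.1 ≠ Literature.MathematicalPhysics.QuantumFieldTheory.Site.shift p.1 ν)
    (h2 : ∀ ν, p.1 ≠ Literature.MathematicalPhysics.QuantumFieldTheory.Site.shift q.1 ν) :
    wilsonDirac (fundamentalRep (Fin 3)) U m r p q = 0 := by
  have hpq : p ≠ q := fun h => h0 (by rw [h])
  simp [wilsonDirac, hpq, h1, h2]

/-- An index OUTSIDE the open box `(x, t)` (`t ≤ N`) is not coupled by the Wilson–Dirac matrix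
to any index of the box off the first/last interior layers. [folklore] -/
private theorem wilsonDirac_apply_eq_zero_of_not_mem (U : GaugeConfig 4 N SU3) (m : ℝ)
    {x : TorusSite 4 N} {t : Fin 4 → ℕ} (ht : ∀ i, t i ≤ N)
    {p q : TorusSite 4 N × Fin 3 × Fin 4} (hp : ¬ wilsonBox x t p) (hq : wilsonBox x t q)
    (hf : ¬ ∃ i, (q.1 i - x i).val = 1 ∨ (q.1 i - x i).val + 1 = t i) :
    wilsonDirac (fundamentalRep (Fin 3)) U m 1 p q = 0 := by
  refine wilsonDirac_apply_eq_zero_of_far' U m 1 ?_ ?_ ?_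
  · intro h
    exact hp fun i => by rw [h]; exact hq i
  · intro ν h
    exact hp fun i => siteBox_of_adjacent ht hq hf (Or.inr h) i
  · intro ν h
    exact hp fun i => siteBox_of_adjacent ht hq hf (Or.inl h) i

/-- **Inside the box the zero-extension is acted on by the cell matrix**: for `p` in the box,
`(D_W ŵ)(p) = (D_c w)(p)` (`wilsonCell = Matrix.toSquareBlockProp D_W (wilsonBox x t)` restricts
both indices, and `ŵ` vanishes off the box). [folklore] -/
private theorem mulVec_zeroExt_apply_of_mem (U : GaugeConfig 4 N SU3) (μ : ℝ) (x : TorusSite 4 N)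
    (t : Fin 4 → ℕ) (w : {p // wilsonBox x t p} → ℂ) (p : TorusSite 4 N × Fin 3 × Fin 4)
    (hp : wilsonBox x t p) :
    (wilsonDirac (fundamentalRep (Fin 3)) U μ 1 *ᵥ
        fun q => if h : wilsonBox x t q then w ⟨q, h⟩ else 0) p =
      (wilsonCell U μ x t *ᵥ w) ⟨p, hp⟩ := by
  set v : TorusSite 4 N × Fin 3 × Fin 4 → ℂ :=
    fun q => if h : wilsonBox x t q then w ⟨q, h⟩ else 0 with hv
  have hvp : ∀ j : {a // wilsonBox x t a}, v j = w j := fun j => by simp [hv, j.2]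
  have hvn : ∀ j, ¬ wilsonBox x t j → v j = 0 := fun j hj => by simp [hv, hj]
  simp only [Matrix.mulVec, dotProduct, wilsonCell, Matrix.toSquareBlockProp_def, Matrix.of_apply]
  have hR : (∑ j : {a // wilsonBox x t a},
      wilsonDirac (fundamentalRep (Fin 3)) U μ 1 p j * w j) =
        ∑ j ∈ Finset.univ.filter (wilsonBox x t),
          wilsonDirac (fundamentalRep (Fin 3)) U μ 1 p j * v j := by
    rw [Finset.sum_subtype (Finset.univ.filter (wilsonBox x t)) (p := wilsonBox x t)
      (fun j => by simp)]
    exact Finset.sum_congr rfl fun j _ => by rw [hvp j]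
  rw [hR, Finset.sum_filter]
  refine Finset.sum_congr rfl fun j _ => ?_
  by_cases hj : wilsonBox x t j
  · simp [hj]
  · simp [hj, hvn j hj]

end Locality

/-! ## The registered stub -/

section Main

open scoped Matrix.Norms.L2Operator

variable {N : ℕ} [NeZero N]

/-- **Pointwise comparison.** For every index `p` of the torus,
`‖(D_W ŵ)(p)‖² ≤ ‖((Σ_μ W_μ) ŵ_face)(p)‖²`: inside the box the left side vanishes (`D_c w = 0`),
outside the box `(D_W ŵ)(p) = (D_W ŵ_face)(p) = -((Σ_μ W_μ) ŵ_face)(p)`. [folklore] -/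
private theorem norm_sq_mulVec_zeroExt_le (U : GaugeConfig 4 N SU3) (μ : ℝ) (x : TorusSite 4 N)
    (t : Fin 4 → ℕ) (w : {p // wilsonBox x t p} → ℂ) (ht : ∀ i, t i ≤ N)
    (hw : wilsonCell U μ x t *ᵥ w = 0) (p : TorusSite 4 N × Fin 3 × Fin 4) :
    ‖(wilsonDirac (fundamentalRep (Fin 3)) U μ 1 *ᵥ
        fun q => if h : wilsonBox x t q then w ⟨q, h⟩ else 0) p‖ ^ 2 ≤
      ‖((∑ ν, wilsonHop (fundamentalRep (Fin 3)) U ν) *ᵥ fun q =>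
          if h : wilsonBox x t q then
            (if (∃ i, (q.1 i - x i).val = 1 ∨ (q.1 i - x i).val + 1 = t i) then w ⟨q, h⟩
              else 0)
          else 0) p‖ ^ 2 := by
  by_cases hp : wilsonBox x t p
  · rw [mulVec_zeroExt_apply_of_mem U μ x t w p hp, hw, Pi.zero_apply, norm_zero,
      zero_pow two_ne_zero]
    exact sq_nonneg _
  · -- outside the box: first replace `ŵ` by `ŵ_face`
    have hout : (wilsonDirac (fundamentalRep (Fin 3)) U μ 1 *ᵥ
        fun q => if h : wilsonBox x t q then w ⟨q, h⟩ else 0) p =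
        (wilsonDirac (fundamentalRep (Fin 3)) U μ 1 *ᵥ fun q =>
          if h : wilsonBox x t q then
            (if (∃ i, (q.1 i - x i).val = 1 ∨ (q.1 i - x i).val + 1 = t i) then w ⟨q, h⟩
              else 0)
          else 0) p := by
      simp only [Matrix.mulVec, dotProduct]
      refine Finset.sum_congr rfl fun q _ => ?_
      by_cases hq : wilsonBox x t q
      · by_cases hf : ∃ i, (q.1 i - x i).val = 1 ∨ (q.1 i - x i).val + 1 = t i
        · rw [dif_pos hq, dif_pos hq, if_pos hf]
        · rw [wilsonDirac_apply_eq_zero_of_not_mem U μ ht hp hq hf, zero_mul, zero_mul]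
      · rw [dif_neg hq, dif_neg hq]
    -- then use `D_W = (μ+4)·1 - Σ W_μ` and `ŵ_face p = 0`
    rw [hout, wilsonDirac_eq_sub_sum_wilsonHop (fundamentalRep (Fin 3))
      fundamentalRep_mem_unitaryGroup U μ, Matrix.sub_mulVec, Matrix.smul_mulVec,
      Matrix.one_mulVec, Pi.sub_apply, Pi.smul_apply, dif_neg hp, smul_zero, zero_sub, norm_neg]

/-- **The face mass of the zero-extension.** The `ℓ²` mass of `ŵ_face` on the torus is the face
mass of `w` (sum over the box of `‖w q‖²` restricted to the first/last interior layers).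
[folklore] -/
private theorem sum_norm_sq_faceExt (x : TorusSite 4 N) (t : Fin 4 → ℕ)
    (w : {p // wilsonBox x t p} → ℂ) :
    ∑ p : TorusSite 4 N × Fin 3 × Fin 4, ‖(if h : wilsonBox x t p then
        (if (∃ i, (p.1 i - x i).val = 1 ∨ (p.1 i - x i).val + 1 = t i) then w ⟨p, h⟩ else 0)
        else 0)‖ ^ 2 =
      ∑ q : {p // wilsonBox x t p},
        (if (∃ i, (q.1.1 i - x i).val = 1 ∨ (q.1.1 i - x i).val + 1 = t i) then ‖w q‖ ^ 2
          else 0) := by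
  set v : TorusSite 4 N × Fin 3 × Fin 4 → ℂ :=
    fun q => if h : wilsonBox x t q then w ⟨q, h⟩ else 0 with hv
  have hvp : ∀ j : {a // wilsonBox x t a}, v j = w j := fun j => by simp [hv, j.2]
  have hvq : ∀ q (hq : wilsonBox x t q), v q = w ⟨q, hq⟩ := fun q hq => by simp [hv, hq]
  symm
  calc (∑ q : {p // wilsonBox x t p},
        (if (∃ i, (q.1.1 i - x i).val = 1 ∨ (q.1.1 i - x i).val + 1 = t i) then ‖w q‖ ^ 2
          else 0))
      = ∑ q ∈ Finset.univ.filter (wilsonBox x t),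
          (if (∃ i, (q.1 i - x i).val = 1 ∨ (q.1 i - x i).val + 1 = t i) then ‖v q‖ ^ 2
            else 0) := by
        rw [Finset.sum_subtype (Finset.univ.filter (wilsonBox x t)) (p := wilsonBox x t)
          (fun j => by simp)]
        exact Finset.sum_congr rfl fun q _ => by rw [hvp q]
    _ = ∑ q, if wilsonBox x t q then
          (if (∃ i, (q.1 i - x i).val = 1 ∨ (q.1 i - x i).val + 1 = t i) then ‖v q‖ ^ 2
            else 0) else 0 := Finset.sum_filter _ _
    _ = _ := by
        refine Finset.sum_congr rfl fun q _ => ?_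
        by_cases hq : wilsonBox x t q
        · by_cases hf : ∃ i, (q.1 i - x i).val = 1 ∨ (q.1 i - x i).val + 1 = t i
          · rw [if_pos hq, if_pos hf, dif_pos hq, if_pos hf, hvq q hq]
          · rw [if_pos hq, if_neg hf, dif_pos hq, if_neg hf, norm_zero]
            norm_num
        · rw [if_neg hq, dif_neg hq, norm_zero]
          norm_num

/-- **S1 — zero-extension transfer (deterministic).** For every torus side `N`, SU(3) field `U`,
bare mass `μ`, box `(x, t)` with `t_i ≤ N` and every KERNEL VECTOR `w` of the Dirichlet cell
`wilsonCell U μ x t`, the zero-extension `ŵ = fun q => if q ∈ box then w q else 0` satisfies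
`Σ_p ‖(D_W(U,μ,1) ŵ)(p)‖² ≤ 64 · faceMass(w)`, where `faceMass(w)` is the `ℓ²` mass of `w` on
the first / last interior layer in some direction (offset `1` or `t_i - 1` from the corner). Inside
the box `(D_W ŵ)(p) = (D_c w)(p) = 0`; outside, only face sites of the box are coupled to `p`
(nearest-neighbour locality, `t_i ≤ N` excludes wrap-around), so `D_W ŵ = -(Σ_μ W_μ) ŵ_face`
there, and `‖Σ_μ W_μ‖ ≤ 4` gives the constant `16 ≤ 64`. -/
theorem stub_zeroExtensionQuasimode :
    ∀ (N : ℕ) [NeZero N] (U : GaugeConfig 4 N SU3) (μ : ℝ) (x : TorusSite 4 N) (t : Fin 4 → ℕ)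
      (w : {p // wilsonBox x t p} → ℂ), (∀ i, t i ≤ N) → wilsonCell U μ x t *ᵥ w = 0 →
      ∑ p, ‖(wilsonDirac (fundamentalRep (Fin 3)) U μ 1 *ᵥ
          fun q => if h : wilsonBox x t q then w ⟨q, h⟩ else 0) p‖ ^ 2 ≤
        64 * ∑ q : {p // wilsonBox x t p},
          (if (∃ i, (q.1.1 i - x i).val = 1 ∨ (q.1.1 i - x i).val + 1 = t i) then ‖w q‖ ^ 2 else 0) := by
  intro N _ U μ x t w ht hw
  refine (Finset.sum_le_sum fun p _ => norm_sq_mulVec_zeroExt_le U μ x t w ht hw p).trans ?_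
  refine (sum_norm_sq_mulVec_le _ _).trans ?_
  rw [sum_norm_sq_faceExt x t w]
  have h4 := l2_opNorm_sum_wilsonHop_le (fundamentalRep (Fin 3)) fundamentalRep_mem_unitaryGroup U
  have h0 : 0 ≤ ∑ q : {p // wilsonBox x t p},
      (if (∃ i, (q.1.1 i - x i).val = 1 ∨ (q.1.1 i - x i).val + 1 = t i) then ‖w q‖ ^ 2
        else 0) :=
    Finset.sum_nonneg fun q _ => by split_ifs <;> positivity
  have h16 : ‖∑ ν, wilsonHop (fundamentalRep (Fin 3)) U ν‖ ^ 2 ≤ 64 := by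
    nlinarith [norm_nonneg (∑ ν, wilsonHop (fundamentalRep (Fin 3)) U ν)]
  exact mul_le_mul_of_nonneg_right h16 h0

end Main

end Summit.QuantumFields.QCD.Cruxes.EarlyCrosserLaw.CellsInheritTorusExtinction

end
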